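import Literature.AlgebraicGeometry.Resolution.Temkin2008
import Literature.AlgebraicGeometry.Resolution.BlowupsIntegral
import Literature.AlgebraicGeometry.Resolution.BlowupsProperProofs
import Mathlib.AlgebraicGeometry.FunctionField
import HarnessLib

/-!
# Temkin 2008: localization of desingularization (Prop. 2.3.4) and the reduction of
# `Temkin2008` to Hironaka's theorem over local rings (Thm. 2.3.6)

Topic: `Literature/AlgebraicGeometry/Resolution`. First layer of the decomposition of the named
fact `Temkin2008` (`Temkin2008.lean`: Noetherian quasi-excellent integral schemes with residue
fields of characteristic zero admit a resolution, Temkin 2008 Thm. 1.1 (i)⇒(ii)). In the source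
the non-embedded case is Thm. 2.3.6, obtained from exactly two ingredients:

1. **Prop. 2.3.4** ("(locdesprop)", localization of desingularization): over a Noetherian
   quasi-excellent base `k` there is resolution of singularities (every integral `k`-scheme of
   finite type admits a desingularization, Def. 2.3.1) as soon as the blow-ups `S'` of the
   integral local `k`-schemes `S = Spec 𝒪_{X,x}` essentially of finite type whose singular locus
   lies over the closed point admit a desingularization — proved in the source by Noetherian
   induction (extend the centre of a local desingularization from the pro-open subscheme
   `Spec 𝒪_{X,x} ×_X X'` to `X'`, Lemma 2.1.1; compose blow-ups, Lemma 2.1.4; enlarge the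
   desingularized open by properness);
2. **Hironaka 1964, Main Theorem I** in the generality recorded by Temkin (p. 13: "Hironaka
   proved in [Hir] that there is embedded resolution of singularities over a local
   quasi-excellent scheme `k` of characteristic zero: Main Theorem 1 establishes non-embedded
   desingularization for schemes of finite type over `k`"), which feeds the local hypothesis
   of Prop. 2.3.4 (a blow-up of `S` is of finite type over `S`).

(The second proof of Thm. 1.1 (i)⇔(ii) in the source, Thm. 3.4.3, goes through the same
Prop. 2.3.4 and replaces ingredient 2 by Cor. 3.4.2 — formal desingularization via Elkik's
algebraization; formal schemes are not available in Mathlib, so that route is not vendored.)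

## Content (namespace `Literature.AlgGeom`)

* `IsDesingularization π` — Temkin's **desingularization** of `X` (Def. 2.2.6 with `Z = ∅`,
  `S = X`, and §2.1: "`f` is `T`-supported … if `|Y| ⊆ |T|`" for the centre `Y`): `π` is a
  blow-up of `X` along an ideal sheaf whose support lies in the singular locus
  `X ∖ Reg X` (an "`X_reg`-admissible blow up"), and `X'` is regular.
  `Scheme.AdmitsDesingularization X` — some desingularization exists.
* `ResolutionOver k` — "there is resolution of singularities over `k`" (Def. 2.3.1, `d = ∞`,
  non-embedded): every integral `k`-scheme of finite type admits a desingularization.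
* `LocalBlowupsAdmitDesingularization k` — condition (iii) of Prop. 2.3.4 (non-embedded,
  `d = ∞`): for every `k`-scheme `X` of finite type and every `x ∈ X` with `𝒪_{X,x}` a domain,
  every blow-up `g : S' → Spec 𝒪_{X,x}` with `S'_sing ⊆ g⁻¹(s)` admits a desingularization.
* `Temkin2008_prop234` — NAMED FACT, Prop. 2.3.4, variant "(1) the resolution is not embedded
  and `Z = Z' = ∅`", implication (iii)⇒(ii), `d = ∞`.
* `Hironaka1964_local` — NAMED FACT, Hironaka's Main Theorem I as used in Thm. 2.3.6: there is
  resolution of singularities over `Spec A` for every local quasi-excellent ring `A` with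
  residue field of characteristic zero.
* `Stacks07QU_localization` — NAMED FACT, Stacks Tag 07QU ("Any localization of a finite type
  ring over a (quasi-)excellent ring is (quasi-)excellent"), the localization clause (the
  finite type clause is `Stacks07QU`, `GeneralLU.lean`).
* PROVED: `genericPoint_mem_regularLocus`, `IsDesingularization.isResolution` /
  `Scheme.AdmitsDesingularization.hasResolution` (a desingularization of a locally Noetherian
  integral scheme is a resolution in the weak sense of this topic: the centre misses the
  generic point, so the blow-up is proper and birational, `IsBlowup.isResolution'`),
  `IsBlowup.isEmpty_of_bot` / `Scheme.admitsDesingularization_of_isEmpty` (the degenerate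
  blow-up along `0`), `Scheme.IsRegular.admitsDesingularization`,
  `isQuasiExcellentRing_stalk` (stalks of schemes locally of finite type over a
  quasi-excellent scheme are quasi-excellent, from the two 07QU facts),
  `charZero_residueField_stalk` (and have residue fields of characteristic zero over a
  `ℚ`-scheme), `Hironaka1964_local.localBlowupsAdmitDesingularization` (ingredient 2 gives
  condition (iii)), and the assembly
  `temkin2008_of_localization : Temkin2008_prop234 → Hironaka1964_local → Stacks07QU →
  Stacks07QU_localization → Temkin2008` (= Thm. 2.3.6, `Z = ∅`, in the weak form `Temkin2008`).

## Faithfulness notes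

* Prop. 2.3.4 as printed (arXiv p. 12): "Let `k` be a noetherian quasi-excellent scheme and `d`
  be either a natural number or infinity, then the following conditions are equivalent. …
  (ii) There is strict embedded resolution of singularities over `k` up to dimension `< d` …
  (iii) If `S` is an integral local `k`-scheme of essentially finite type, `dim(S) < d`,
  `s ∈ S` is the closed point, `f : S' → S` is a blow up and `Z' ↪ S'` is a closed subscheme
  with `(S', Z')_sing ⊂ f⁻¹(s)`, then the pair `(S', Z')` admits a strict desingularization. …
  Similar conditions are equivalent when: (1) the resolution is not embedded and
  `Z = Z' = ∅` …". Vendored: variant (1), only (iii)⇒(ii), only `d = ∞` (so "`dim(S) < d`" and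
  "up to dimension `< d`" are vacuous) — WEAKER than printed. "Local `k`-scheme of essentially
  finite type" is "k-isomorphic to `Spec(𝒪_{X,x})` for a finite type `k`-scheme `X` with a
  point `x ∈ X`" (p. 11); condition (iii) is rendered on the schemes `Spec 𝒪_{X,x}` themselves
  (blow-ups and desingularizations transport along `k`-isomorphisms). `Scheme.IsQuasiExcellent`
  (all affine opens quasi-excellent) is stronger than the source's "covered by spectra of
  quasi-excellent rings" (p. 5) — a hypothesis, so again weaker than printed.
* "Desingularization" (Def. 2.2.6 (i), p. 10): "Given a locally noetherian scheme `X` with a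
  closed subscheme `Z` and a blow up `f : X' → X` with support in `X_sing ∪ Z_sing`, we say that
  `f` desingularizes the pair `(X, Z)` over a subset `S ⊂ X` if `f⁻¹(S) ⊂ (X', Z ×_X X')_reg`.
  If `S = X` … we say that … `f` is a desingularization of the pair. By a desingularization of
  `X` we mean a desingularization of the pair `(X, ∅)`." With `Z = ∅`: a blow-up with support
  in `X_sing` and `X'` regular — `IsDesingularization`. Blow-ups are taken up to isomorphism
  (`IsBlowup`, the universal property, GW Def. 13.90), as the source does ("say simply
  'a blow up `f : X' → X`'", p. 7).
* `Hironaka1964_local`: Hironaka's own hypothesis class (the category 𝔅 of local rings of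
  [Hironaka1964, Ch. 0]) is recorded here in Temkin's reading (p. 3: "any integral scheme of
  finite type over a local quasi-excellent ring of residue characteristic zero admits a
  successive embedded resolution of singularities"; p. 13 quoted above); a succession of
  blow-ups with centres in the singular locus is a single `X_reg`-admissible blow-up by
  Lemma 2.1.4 (Raynaud). The original paper is not held in the literature store (acquisition
  requested); the fact is cited to both sources.
* Stacks 07QU as printed: "Any localization of a finite type ring over a (quasi-)excellent ring
  is (quasi-)excellent." `Stacks07QU` (`GeneralLU.lean`) vendors the finite type algebra;
  `Stacks07QU_localization` vendors the localization (of the ring itself); together they give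
  the printed lemma.

## Sources

* M. Temkin, *Desingularization of quasi-excellent schemes in characteristic zero*, Adv. Math.
  219 (2008) 488–522 = arXiv:math/0703678: §2.1 (p. 7), Def. 2.2.6 (p. 10), Def. 2.3.1 (p. 11),
  Prop. 2.3.4 (p. 12), Thm. 2.3.6 (p. 13), Thm. 3.4.3 (p. 19) (arXiv pagination). [Temkin2008]
* H. Hironaka, *Resolution of singularities of an algebraic variety over a field of
  characteristic zero I*, Ann. of Math. 79 (1964) 109–203, Main Theorem I. [Hironaka1964]
* The Stacks Project, Tag 07QU. [StacksProject]
-/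

noncomputable section

open CategoryTheory AlgebraicGeometry TopologicalSpace IsLocalRing

namespace Literature.AlgebraicGeometry.Resolution

universe u

/-! ## Desingularizations (Temkin Def. 2.2.6, `Z = ∅`) -/

/-- `π : X' ⟶ X` **is a desingularization of `X`** (Temkin 2008, Def. 2.2.6 (i) with `Z = ∅` and
`S = X`; §2.1 for "`T`-supported"): `π` is a blow-up of `X` along some ideal sheaf `J` whose
support (the centre `V(J)`) is contained in the singular locus `X ∖ Reg X` — an
"`X_reg`-admissible blow up" — and `X'` is regular. [cite: Temkin2008, Def. 2.2.6 (i)] -/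
structure IsDesingularization {X' X : Scheme.{u}} (π : X' ⟶ X) : Prop where
  /-- `π` is a blow-up along a centre contained in the singular locus -/
  exists_isBlowup : ∃ J : X.IdealSheafData, IsBlowup π J ∧
    (J.support : Set X) ⊆ (Scheme.regularLocus X)ᶜ
  /-- the source is regular -/
  isRegular : Scheme.IsRegular X'

/-- `X` **admits a desingularization** (Temkin 2008, Def. 2.2.6): there is a blow-up
`π : X' ⟶ X` with centre in the singular locus and `X'` regular.
[cite: Temkin2008, Def. 2.2.6 (i)] -/
def Scheme.AdmitsDesingularization (X : Scheme.{u}) : Prop :=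
  ∃ (X' : Scheme.{u}) (π : X' ⟶ X), IsDesingularization π

/-- **There is resolution of singularities over `k`** (Temkin 2008, Def. 2.3.1, non-embedded,
`d = ∞`: "any integral `k`-scheme `X` of finite type admits a desingularization"; a `k`-scheme
of finite type is a quasi-compact morphism locally of finite type `X ⟶ k`).
[cite: Temkin2008, Def. 2.3.1] -/
def ResolutionOver (k : Scheme.{u}) : Prop :=
  ∀ (X : Scheme.{u}) (f : X ⟶ k) [IsIntegral X] [LocallyOfFiniteType f] [QuasiCompact f],
    Scheme.AdmitsDesingularization X

/-- **Condition (iii) of Temkin 2008, Prop. 2.3.4** (variant (1): not embedded, `Z' = ∅`; `d = ∞`):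
"If `S` is an integral local `k`-scheme of essentially finite type [`S ≅ Spec(𝒪_{X,x})` for a
finite type `k`-scheme `X` with a point `x`], `s ∈ S` is the closed point, `f : S' → S` is a
blow up with `S'_sing ⊂ f⁻¹(s)`, then `S'` admits a desingularization" — rendered on the
schemes `S = Spec 𝒪_{X,x}` (`𝒪_{X,x}` a domain) themselves. [cite: Temkin2008, Prop. 2.3.4 (iii)] -/
def LocalBlowupsAdmitDesingularization (k : Scheme.{u}) : Prop :=
  ∀ (X : Scheme.{u}) (f : X ⟶ k) [LocallyOfFiniteType f] [QuasiCompact f] (x : X),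
    IsDomain (X.presheaf.stalk x) →
    ∀ (S' : Scheme.{u}) (g : S' ⟶ Spec (X.presheaf.stalk x))
      (I : (Spec (X.presheaf.stalk x)).IdealSheafData), IsBlowup g I →
      (∀ s : S', s ∉ Scheme.regularLocus S' → g s = closedPoint (X.presheaf.stalk x)) →
      Scheme.AdmitsDesingularization S'

/-! ## The named facts -/

/-- NAMED FACT — **Temkin 2008, Prop. 2.3.4, localization of desingularization** ("Let `k` be
a noetherian quasi-excellent scheme and `d` be either a natural number or infinity, then the
following conditions are equivalent. … (ii) There is … resolution of singularities over `k` up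
to dimension `< d` … (iii) If `S` is an integral local `k`-scheme of essentially finite type,
`dim(S) < d`, `s ∈ S` is the closed point, `f : S' → S` is a blow up … with
`S'_sing ⊂ f⁻¹(s)`, then `S'` admits a desingularization. … Similar conditions are
equivalent when: (1) the resolution is not embedded and `Z = Z' = ∅`"), vendored as the
implication (iii)⇒(ii) of variant (1) at `d = ∞`: for every Noetherian quasi-excellent scheme
`k`, `LocalBlowupsAdmitDesingularization k → ResolutionOver k`. Users take
`(h : Temkin2008_prop234)`. [cite: Temkin2008, Prop. 2.3.4] -/
def Temkin2008_prop234 : Prop :=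
  ∀ (k : Scheme.{u}) [IsNoetherian k], Scheme.IsQuasiExcellent k →
    LocalBlowupsAdmitDesingularization k → ResolutionOver k

/-- NAMED FACT — **Hironaka 1964, Main Theorem I, over local quasi-excellent rings of residue
characteristic zero**, in the generality recorded and used by Temkin 2008 (p. 13: "Hironaka
proved in [Hir] that there is embedded resolution of singularities over a local quasi-excellent
scheme `k` of characteristic zero: Main Theorem 1 establishes non-embedded desingularization for
schemes of finite type over `k`"; p. 3: "any integral scheme of finite type over a local
quasi-excellent ring of residue characteristic zero admits a successive embedded resolution of
singularities"; the succession of blow-ups is a single `X_reg`-admissible blow-up by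
Lemma 2.1.4): for every local quasi-excellent ring `A` whose residue field has characteristic
zero there is resolution of singularities over `Spec A` (`ResolutionOver`). Users take
`(h : Hironaka1964_local)`.
[cite: Hironaka1964, Main Theorem I] [cite: Temkin2008, §2.3, Thm. 2.3.6 (p. 13)] -/
def Hironaka1964_local : Prop :=
  ∀ (A : Type u) [CommRing A] [IsLocalRing A], IsQuasiExcellentRing A →
    CharZero (ResidueField A) → ResolutionOver (Spec (.of A))

/-- NAMED FACT — **localizations of quasi-excellent rings are quasi-excellent** (Stacks,
Tag 07QU: "Any localization of a finite type ring over a (quasi-)excellent ring is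
(quasi-)excellent"; the localization clause, for the ring itself; the finite type clause is
`Stacks07QU`). Users take `(h : Stacks07QU_localization)`. [cite: StacksProject, Tag 07QU] -/
def Stacks07QU_localization : Prop :=
  ∀ (A B : Type u) [CommRing A] [CommRing B] [Algebra A B] (M : Submonoid A),
    IsLocalization M B → IsQuasiExcellentRing A → IsQuasiExcellentRing B

/-! ## Desingularizations are resolutions -/

/-- The generic point of an integral scheme is a regular point (its local ring is the function
field). [folklore] -/
theorem genericPoint_mem_regularLocus (X : Scheme.{u}) [IsIntegral X] :
    genericPoint X ∈ Scheme.regularLocus X := by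
  change IsRegularLocalRing X.functionField
  infer_instance

/-- A regular scheme is its own desingularization: the identity is the blow-up along the unit
ideal (GW, remark after Def. 13.90), whose centre is empty. [folklore] -/
theorem Scheme.IsRegular.admitsDesingularization {X : Scheme.{u}} (h : Scheme.IsRegular X) :
    Scheme.AdmitsDesingularization X :=
  ⟨X, 𝟙 X, ⟨⊤, isBlowup_id_top X, by simp [Scheme.IdealSheafData.support_top]⟩, h⟩

/-- The empty scheme admits a desingularization (the identity). [folklore] -/
theorem Scheme.admitsDesingularization_of_isEmpty (X : Scheme.{u}) [IsEmpty X] :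
    Scheme.AdmitsDesingularization X :=
  Scheme.IsRegular.admitsDesingularization fun x => (IsEmpty.false x).elim

/-- A blow-up along the zero ideal sheaf is empty: the exceptional divisor `π⁻¹(V(0)) = X'` would
be an effective Cartier divisor with equation `0`, a non-zero-divisor only over the zero ring
(Temkin, Def. 2.2.6: "`Bl_X(X) = ∅`"). [cite: Temkin2008, Def. 2.2.6] -/
theorem IsBlowup.isEmpty_of_bot {X' X : Scheme.{u}} {π : X' ⟶ X}
    (h : IsBlowup π (⊥ : X.IdealSheafData)) : IsEmpty X' := by
  refine ⟨fun x => ?_⟩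
  have hc := h.isEffectiveCartier
  rw [Scheme.IdealSheafData.comap_bot] at hc
  obtain ⟨U, hxU, f, hf, hfU⟩ := hc x
  have hf0 : f = 0 := by
    have : f ∈ Ideal.span {f} := Ideal.mem_span_singleton_self f
    rw [← hfU] at this
    simpa [Scheme.IdealSheafData.ideal_bot] using this
  subst hf0
  haveI : Nontrivial Γ(X', U) := (X'.evaluation U x hxU).hom.domain_nontrivial
  exact zero_notMem_nonZeroDivisors hf

/-- **A desingularization of a locally Noetherian integral scheme is a resolution of
singularities** (`IsResolution`: proper, birational, regular source): the centre lies in the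
singular locus, which misses the generic point, so the blown-up ideal sheaf is nonzero and
`IsBlowup.isResolution'` applies (blow-ups of locally Noetherian schemes are proper,
`stacks02NS_holds`; blow-ups of integral schemes along nonzero ideals are birational).
[cite: Temkin2008, §1 (p. 3) and Def. 2.2.6] -/
theorem IsDesingularization.isResolution {X' X : Scheme.{u}} [IsIntegral X]
    [IsLocallyNoetherian X] {π : X' ⟶ X} (h : IsDesingularization π) : IsResolution π := by
  obtain ⟨J, hJ, hsupp⟩ := h.exists_isBlowup
  have hne : J ≠ ⊥ := by
    rintro rfl
    have : genericPoint X ∈ ((⊥ : X.IdealSheafData).support : Set X) := by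
      rw [Scheme.IdealSheafData.support_bot]; trivial
    exact hsupp this (genericPoint_mem_regularLocus X)
  exact hJ.isResolution' stacks02NS_holds hne h.isRegular

/-- A locally Noetherian integral scheme admitting a desingularization has a resolution
(`Scheme.HasResolution`). [cite: Temkin2008, Def. 2.2.6] -/
theorem Scheme.AdmitsDesingularization.hasResolution {X : Scheme.{u}} [IsIntegral X]
    [IsLocallyNoetherian X] (h : Scheme.AdmitsDesingularization X) :
    Scheme.HasResolution X := by
  obtain ⟨X', π, hπ⟩ := h
  exact ⟨X', π, hπ.isResolution⟩

/-! ## Stalks of schemes of finite type over a quasi-excellent `ℚ`-scheme -/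

/-- **Stalks of a scheme locally of finite type over a quasi-excellent scheme are
quasi-excellent** (under the two clauses of Stacks 07QU): `𝒪_{X,x}` is the localization at a
prime of `Γ(X, V)` for an affine open `x ∈ V ⊆ f⁻¹(U)`, `U ⊆ k` affine, and `Γ(X, V)` is of
finite type over the quasi-excellent ring `Γ(k, U)`. [cite: StacksProject, Tag 07QU] -/
theorem isQuasiExcellentRing_stalk (h07 : Stacks07QU.{u}) (h07l : Stacks07QU_localization.{u})
    {X k : Scheme.{u}} (f : X ⟶ k) [LocallyOfFiniteType f] (hk : Scheme.IsQuasiExcellent k)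
    (x : X) : IsQuasiExcellentRing (X.presheaf.stalk x) := by
  obtain ⟨U, hU, hfxU, -⟩ :=
    exists_isAffineOpen_mem_and_subset (X := k) (x := f x) (U := ⊤) trivial
  obtain ⟨V, hV, hxV, hVU⟩ :=
    exists_isAffineOpen_mem_and_subset (X := X) (x := x) (U := f ⁻¹ᵁ U) hfxU
  have hft : RingHom.FiniteType (f.appLE U V hVU).hom :=
    HasRingHomProperty.appLE @LocallyOfFiniteType f ‹_› ⟨U, hU⟩ ⟨V, hV⟩ hVU
  have hΓV : IsQuasiExcellentRing Γ(X, V) := by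
    letI : Algebra Γ(k, U) Γ(X, V) := (f.appLE U V hVU).hom.toAlgebra
    haveI : Algebra.FiniteType Γ(k, U) Γ(X, V) := hft
    exact h07 Γ(k, U) Γ(X, V) (hk ⟨U, hU⟩) ‹_›
  letI : Algebra Γ(X, V) (X.presheaf.stalk x) :=
    TopCat.Presheaf.algebra_section_stalk X.presheaf (⟨x, hxV⟩ : V)
  have hloc : IsLocalization.AtPrime (X.presheaf.stalk x) (hV.primeIdealOf ⟨x, hxV⟩).asIdeal :=
    hV.isLocalization_stalk ⟨x, hxV⟩
  exact h07l Γ(X, V) (X.presheaf.stalk x) (hV.primeIdealOf ⟨x, hxV⟩).asIdeal.primeCompl hloc hΓV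

/-- **Over a scheme whose residue fields have characteristic zero, all stalks have residue
fields of characteristic zero**: the nonzero integers are units in `𝒪_{k,f(x)}`, hence in
`𝒪_{X,x}` via `f^♯_x`, hence nonzero in `κ(x)`. [folklore] -/
theorem charZero_residueField_stalk {X k : Scheme.{u}} (f : X ⟶ k)
    (h0 : ∀ y : k, CharZero (k.residueField y)) (x : X) :
    CharZero (ResidueField (X.presheaf.stalk x)) := by
  haveI : CharZero (ResidueField (k.presheaf.stalk (f x))) := h0 (f x)
  exact charZero_of_ringHom_of_isUnit_natCast
    ((residue (X.presheaf.stalk x)).comp (f.stalkMap x).hom)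
    (isUnit_natCast_of_charZero_residueField (A := k.presheaf.stalk (f x)))

/-! ## Thm. 2.3.6: `Temkin2008` from Prop. 2.3.4 and Hironaka's theorem -/

/-- **Hironaka's theorem supplies condition (iii) of Prop. 2.3.4** over a quasi-excellent scheme
`k` with residue fields of characteristic zero (Temkin 2008, proof of Thm. 2.3.6: "Accordingly
to proposition 2.3.4, Hironaka's result implies the following theorem"): for `X` of finite type
over `k` and `x ∈ X` with `𝒪_{X,x}` a domain, `𝒪_{X,x}` is a local quasi-excellent ring
(`isQuasiExcellentRing_stalk`) with residue field of characteristic zero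
(`charZero_residueField_stalk`); a blow-up `S'` of `Spec 𝒪_{X,x}` along a nonzero ideal is
integral and proper — in particular of finite type — over it, so `Hironaka1964_local`
desingularizes `S'`; along the zero ideal `S' = ∅`. [cite: Temkin2008, Thm. 2.3.6] -/
theorem Hironaka1964_local.localBlowupsAdmitDesingularization (hH : Hironaka1964_local.{u})
    (h07 : Stacks07QU.{u}) (h07l : Stacks07QU_localization.{u}) {k : Scheme.{u}}
    (hk : Scheme.IsQuasiExcellent k) (h0 : ∀ y : k, CharZero (k.residueField y)) :
    LocalBlowupsAdmitDesingularization k := by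
  intro X f _ _ x hdom S' g I hg _hsing
  by_cases hI : I = ⊥
  · subst hI
    haveI := hg.isEmpty_of_bot
    exact Scheme.admitsDesingularization_of_isEmpty S'
  have hA : IsQuasiExcellentRing (X.presheaf.stalk x) := isQuasiExcellentRing_stalk h07 h07l f hk x
  have hA0 : CharZero (ResidueField (X.presheaf.stalk x)) := charZero_residueField_stalk f h0 x
  haveI : IsNoetherianRing (X.presheaf.stalk x) := hA.isNoetherianRing
  haveI : IsIntegral S' := hg.isIntegral hI
  haveI : IsProper g := hg.isProper
  exact hH (X.presheaf.stalk x) hA hA0 S' g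

/-- **Temkin 2008, Thm. 2.3.6 (`Z = ∅`), weak form = `Temkin2008`, from its two ingredients**:
for a Noetherian quasi-excellent integral scheme `X` with residue fields of characteristic zero,
Prop. 2.3.4 over the base `k = X` — its local hypothesis supplied by Hironaka's theorem
(`Hironaka1964_local.localBlowupsAdmitDesingularization`) — gives resolution of singularities
over `X`; applied to `X` itself (of finite type over `X` by the identity) it yields a
desingularization, which is a resolution (`Scheme.AdmitsDesingularization.hasResolution`).
[cite: Temkin2008, Thm. 2.3.6 and Prop. 2.3.4] -/
theorem temkin2008_of_localization (hP : Temkin2008_prop234.{u}) (hH : Hironaka1964_local.{u})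
    (h07 : Stacks07QU.{u}) (h07l : Stacks07QU_localization.{u}) : Temkin2008.{u} := by
  intro X _ _ hqe h0
  have hres : ResolutionOver X :=
    hP X hqe (hH.localBlowupsAdmitDesingularization h07 h07l hqe h0)
  exact (hres X (𝟙 X)).hasResolution

end Literature.AlgebraicGeometry.Resolution

end
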